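import Summits.BirchSwinnertonDyer.BirchSwinnertonDyer.Theses.InertBadSignedBranches
import Summits.BirchSwinnertonDyer.Rank1Residual.X12.ClassClosureO10Readings
import Summits.BirchSwinnertonDyer.Rank1Residual.X12.InertCoreEveryCurve
import Summits.BirchSwinnertonDyer.Rank1Residual.Additive.QuadraticBranchValuationOfBSDp
import Summits.BirchSwinnertonDyer.Rank1Residual.Additive.QuadraticBranchPeriodRatioOfManinFact
import HarnessLib

/-!
# Route `InertBadSignedBranches` (rung K8), crux `CccOneLawOnTypeIstarZero`: modulo the route's OWN
# support items the crux IS `BSD_p` on the type, i.e. (the upper half being published) the LOWER HALF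
# `LowerHalfOnType p I₀*` — and the non-vanishing clause of the law is a consequence of the readings
# (helper toward stmt-BirchSwinnertonDyer-19223; cell bsd-cm, seat bsd-cm-inert g11; nothing asserted)

The crux C-cc-1 on the signed type `(p, I₀*)`, `p ≥ 5` (`Additive.QuadraticBranchPAdicGrossZagierValuationAt
W p` for every rank-one `W` of the type) says, for every good `a_p = 0` twin datum `(V, C, f, ϖ, L)` and
every generator `P` of level `n`: `coeff₁ L ≠ 0 ∧ v_p(coeff₁ L) = 2n + ord_p(#Ш_an·Tam/#tors²)`. The
node of record (x1b p402929, `X12.O10.bsdp_of_hasSignedLocalType_IstarZero_of_valuation_of_readings`)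
turns it, with the route's support items `PrintReadingsInert` ((C1_η), (R2), Kobayashi 7.4 (ii) exact)
and `PublishedFactsInert`, into `BSD(W, p)`. THIS FILE closes the circle in the kernel:

* §1 **`coeff_one_ne_zero_of_exactReading`** — the NON-VANISHING clause `coeff₁ L_p⁻(V, η, X) ≠ 0` is a
  CONSEQUENCE of the exact Thm-7.4 reading + Poitou–Tate + `Ш(W)[p^∞]` finite in Mordell–Weil rank
  one (x1b's `LevelBridge.isTorsion_and_constantCoeff_ne_zero_of_quadraticTwist_signedPrime_rankOne`:
  the characteristic element of the strict minus dual Selmer module has non-zero constant term, and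
  the reading identifies it with `L/X`). So only the VALUATION equation of the crux is open.
* §2 **`quadraticBranchPAdicGrossZagierValuationAt_of_bsdp_of_readings`** — per pair: `BSD(W, p)` +
  the readings + (C1_η) on the twins ⟹ C-cc-1 at `(W, p)` (g0's converse
  `quadraticBranchPAdicGrossZagierValuationAt_of_bsdp` with its (C3_η) and `coeff₁ ≠ 0` inputs
  DISCHARGED from the readings by x1b's file 123 and §1).
* §3 **`cccOneLawOnTypeIstarZero_iff_bsdpOnType`** — given `PrintReadingsInert` and
  `PublishedFactsInert` (the route's items 19226 / 19227, hypotheses here):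
  `CccOneLawOnTypeIstarZero ↔ (∀ p ≥ 5, ∀ W of type (p, I₀*) with r_an = 1, BSDp W p)`.
* §4 **`cccOneLawAt_iff_lowerHalfOnType_of_seven_lt`** — at each `p ≥ 11`, with the eleven
  published facts of x1b's every-curve upper half (`X12.missingUpperBoundAt_of_classX12_of_cmInert`:
  Kolyvagin / Matar–Nekovář over a Friedberg–Hoffstein field, Rubin–Burungale–Flach for the twist,
  Edixhoven, Cassels): the `p`-slice of the crux ↔ `X12.O10.LowerHalfOnType p I₀*`
  (`ord_p #Ш_an ≤ ord_p #Ш` on the type). So the crux's open content at `p ≥ 11` is EXACTLY the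
  main-conjecture half of `BSD_p` on the type (= STEP L / Kolyvagin's `m_∞` at Heegner data by x1b's
  `InertCoreStepL` rigidity) — in particular it has no `p`-adic-`L`-function content beyond the
  readings; at `p ∈ {5, 7}` the same holds modulo the Manin datum of the upper half.
* §5 **`quadraticBranchPAdicGrossZagierValuationAt_of_shaAn_unit_of_seven_lt`** — the sub-type rung:
  C-cc-1 holds at every pair of the type with `p ≥ 11` whose analytic `#Ш` is a CERTIFIED `p`-adic
  unit (route T-KR), modulo readings + published facts; the lane certifies `ord_p #Ш_an = 0` on
  274/274 O10-PS census pairs (x1b E1-η), so per pair the crux carries no content there.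

HONEST LABEL: every statement is CONDITIONAL on displayed hypotheses — typed conjecture items ((C1_η),
(R2)), reading texts (Kobayashi 7.4 (ii)), published named facts, certified data; nothing is booked;
no label moves; the crux 19223 and O10 stay OPEN at class level. What this is NOT: not a proof of
the lower half on the type; not a new typed input; no Literature statement, no named fact minted.
[cite: Kobayashi2003, §4 (p. 8), Thm. 7.4 (p. 13), Thm. 9.3 (p. 26)] [cite: Miller2011LMS, §1 and Def. 1.1]
[cite: KitajimaOtsuki2018, Main Thm. 1.3 (arXiv:1607.03612 p. 3)] [cite: MatarNekovar2019, Thm. 0.3 and §0.11]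
[cite: GreenbergLNM1716, §4 Thm. 4.1 and Lemma 4.2 (p. 102)]
-/

set_option autoImplicit false
set_option linter.dupNamespace false

noncomputable section

open scoped Classical MatrixGroups ModularForm NumberField

open CongruenceSubgroup Field WeierstrassCurve NumberField IsDedekindDomain
open Literature.NumberTheory.EllipticCurves
open Literature.NumberTheory.EllipticCurves.ModularForms
open Literature.NumberTheory.EllipticCurves.Kobayashi2003 hiding IsQuadraticBranchMinusLFunction
open Literature.NumberTheory.EllipticCurves.Rank1Residual
open Literature.NumberTheory.EllipticCurves.Rank1Residual.Typed
open Literature.NumberTheory.GaloisRepresentations Literature.NumberTheory.GaloisCohomology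
open Summit.BirchSwinnertonDyer.Rank1Residual
open Summit.BirchSwinnertonDyer.Rank1Residual.Additive
open Summit.BirchSwinnertonDyer.Rank1Residual.X12.O10

namespace Summit.BirchSwinnertonDyer.BirchSwinnertonDyer.Theorems.CccOneLowerHalf

variable (W : WeierstrassCurve ℚ) [W.IsElliptic] [W.IsGloballyMinimal] (p : ℕ) [hp : Fact p.Prime]

/-! ## §1 The non-vanishing clause of the law is a consequence of the exact reading -/

/-- **`coeff₁ L_p⁻(V, η, X) ≠ 0` in analytic rank one FROM the exact Kobayashi-7.4 reading.** For `W`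
globally minimal with `Ш(W)[p^∞]` finite, a good `a_p = 0` twin datum `C • W^{(p*)} = V` (`p` odd),
a branch function `L` (`IsQuadraticBranchMinusLFunction f p ϖ L`, so `L = X·L'`, `L'(0) = coeff₁ L`), a
generator `P` of `W(ℚ)/tors` of `p`-divisibility level `n` in `W(ℚ_p)`, and the reading "for the
cyclotomic `ℤ_p`-extension and every strict minus dual datum `D`: `char D = (L')`" (`hchar`):
`coeff₁ L ≠ 0`. Proof: x1b's `isTorsion_and_constantCoeff_ne_zero_of_quadraticTwist_signedPrime_rankOne`
(Poitou–Tate `hPT`, Mordell–Weil rank one, control at the bottom layer) says every generator of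
`char D` has non-zero constant term. CONDITIONAL on `hPT` and the reading; nothing booked.
[cite: Kobayashi2003, §4 (p. 8) and Thm. 7.4 (p. 13)] [cite: GreenbergLNM1716, §4 Thm. 4.1 and Lemma 4.2 (p. 102)]
[cite: MilneADT2006, Ch. I, Thm. 4.10] -/
theorem coeff_one_ne_zero_of_exactReading (hPT : poitouTate_selmerStructure_duality_real ℚ)
    [hSha : Finite (AddCommGroup.primaryComponent W.sha p)] (hp2 : p ≠ 2)
    {V : WeierstrassCurve ℚ} [V.IsElliptic] [V.IsGloballyMinimal] (C : VariableChange ℚ)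
    (hCV : C • W.quadraticTwist ((-1) ^ (p / 2) * p) = V)
    (hgood : V.HasGoodReductionAtPrime p) (hap : V.frobeniusTrace p = 0)
    {N : ℕ} [NeZero N] {f : CuspForm (Gamma0 N) 2} {ϖ : ℚ} {L : IwasawaAlgebra p}
    (hL : IsQuadraticBranchMinusLFunction f p ϖ L)
    {P : W.toAffine.Point} (hP : ¬ IsOfFinAddOrder P)
    (hgen : ∀ R : W.toAffine.Point, ∃ (k : ℤ) (T : W.toAffine.Point), IsOfFinAddOrder T ∧ R = k • P + T)
    {n : ℕ} (hdiv : ∃ Q : (W.baseChange ℚ_[p]).toAffine.Point, p ^ n • Q = W.toPadicPoint p P)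
    (hndiv : ∀ Q : (W.baseChange ℚ_[p]).toAffine.Point, p ^ (n + 1) • Q ≠ W.toPadicPoint p P)
    (hchar : ∀ (κ : ZpExtension ℚ p) (γ : Field.absoluteGaloisGroup ℚ),
        κ.IsCyclotomic → κ.IsTopGenerator γ → IsCyclotomicVariable p γ →
      ∀ (D : StrictSignedSelmerDualData W κ ℚ_[p] γ (-1)) (L' : IwasawaAlgebra p),
        L = PowerSeries.X * L' → D.charIdeal = Ideal.span {L'}) :
    PowerSeries.coeff 1 L ≠ 0 := by
  set v₀ := (Rat.HeightOneSpectrum.primesEquiv (R := 𝓞 ℚ)).symm ⟨p, hp.out⟩ with hv₀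
  -- the cyclotomic `ℤ_p`-extension of `ℚ`, a normalised topological generator, a strict-minus dual datum
  obtain ⟨γ, hγ, hχ⟩ := CyclotomicZp.exists_isTopGenerator_zpExtension p
  have hκ := CyclotomicZp.isCyclotomic_zpExtension p
  have hγc : IsCyclotomicVariable p γ := ⟨1, IsOfFinOrder.one, by rw [mul_one]; exact hχ⟩
  obtain ⟨D⟩ := nonempty_strictSignedSelmerDualData W (CyclotomicZp.zpExtension p) ℚ_[p] (-1) hγ
  -- `L = X·L'`, `L'(0) = coeff₁ L`, `char D = (L')`
  obtain ⟨L', hLL', hL'0⟩ := hL.exists_eq_X_mul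
  have hcharL' : D.charIdeal = Ideal.span {L'} := hchar _ γ hκ hγ hγc D L' hLL'
  -- the exceptional set: the places `≠ v₀` off which `W` has good reduction
  obtain ⟨S, hS⟩ := exists_finset_forall_not_mem_good W p
  have hpT : v₀ ∉ S.erase v₀ := fun h ↦ (Finset.mem_erase.mp h).1 rfl
  have hTmem : ∀ v : HeightOneSpectrum (𝓞 ℚ), v ≠ v₀ →
      p ∣ (W.baseChange (v.adicCompletion ℚ)).localTamagawaNumber (v.adicCompletionIntegers ℚ) →
        v ∈ S.erase v₀ := by
    intro v hv hdvd
    refine Finset.mem_erase.mpr ⟨hv, ?_⟩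
    by_contra hvS
    rw [W.localTamagawaNumber_eq_one_of_hasGoodReductionAt_holds v (hS v hvS).2] at hdvd
    exact hp.out.one_lt.ne' (Nat.dvd_one.mp hdvd)
  obtain ⟨Q, hPQ⟩ := hdiv
  obtain ⟨-, -, hX⟩ :=
    LevelBridge.isTorsion_and_constantCoeff_ne_zero_of_quadraticTwist_signedPrime_rankOne W
      (CyclotomicZp.zpExtension p) hp2 hκ C V hCV hgood hap hPT P hP hgen hPQ hndiv (S.erase v₀) hpT
      hTmem hγ D
  rw [← hL'0]
  exact (hX L' hcharL').2

/-! ## §2 Per pair: C-cc-1 at `(W, p)` FROM `BSD(W, p)` and the readings -/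

/-- **C-cc-1 at `(W, p)` ⟸ `BSD(W, p)` + Poitou–Tate + GZK + modularity + (R2) + the exact Kobayashi-7.4
reading + (C1_η) on the good twins of `W`.** g0's `quadraticBranchPAdicGrossZagierValuationAt_of_bsdp`
with (C3_η) supplied by x1b's `quadraticBranchOddStrictExactControlOfPlusMCAt_of_readings` and the
non-vanishing by §1: so `BSD(W, p)` and C-cc-1 at `(W, p)` are EQUIVALENT modulo readings and named
facts (forward direction = x1b p401735). CONDITIONAL; nothing booked.
[cite: Kobayashi2003, §4 (p. 8), Thm. 7.4 (p. 13), Thm. 9.3 (p. 26)] [cite: Miller2011LMS, §1 and Def. 1.1]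
[cite: KitajimaOtsuki2018, Main Thm. 1.3 (arXiv:1607.03612 p. 3)] -/
theorem quadraticBranchPAdicGrossZagierValuationAt_of_bsdp_of_readings
    (hmod : hasEntireLFunction_rat) (hGZK : rank_eq_analyticRank_of_analyticRank_le_one)
    (hPT : poitouTate_selmerStructure_duality_real ℚ) (hB : BSDp W p)
    (hR2 : OddBranchStrictMinusNoFiniteSubmoduleAt W p)
    (h74x : ∀ (V : WeierstrassCurve ℚ) [V.IsElliptic] [V.IsGloballyMinimal] (C : VariableChange ℚ)
        {N : ℕ} [NeZero N] {f : CuspForm (Gamma0 N) 2},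
        p ≠ 2 → C • W.quadraticTwist ((-1) ^ (p / 2) * p) = V →
        V.HasGoodReductionAtPrime p → V.frobeniusTrace p = 0 →
        QuadraticBranchPlusMainConjectureAt V p → IsNewformOf V f →
        ∀ (ϖ : ℚ), (if Even (p / 2) then (ϖ : ℝ) * V.realPeriodRat = plusPeriod f
            else (ϖ : ℝ) * V.imaginaryPeriodRat = minusPeriod f) →
        ∀ (Lη : IwasawaAlgebra p), IsQuadraticBranchMinusLFunction f p ϖ Lη →
        ∀ (κ : ZpExtension ℚ p) (γ : Field.absoluteGaloisGroup ℚ),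
          κ.IsCyclotomic → κ.IsTopGenerator γ → IsCyclotomicVariable p γ →
        ∀ (D : StrictSignedSelmerDualData W κ ℚ_[p] γ (-1)) (L' : IwasawaAlgebra p),
          Lη = PowerSeries.X * L' → D.charIdeal = Ideal.span {L'})
    (h1 : ∀ (V : WeierstrassCurve ℚ) [V.IsElliptic] [V.IsGloballyMinimal] (C : VariableChange ℚ),
      C • W.quadraticTwist ((-1) ^ (p / 2) * p) = V → V.HasGoodReductionAtPrime p →
      V.frobeniusTrace p = 0 → QuadraticBranchPlusMainConjectureAt V p) :
    QuadraticBranchPAdicGrossZagierValuationAt W p := by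
  intro V _ _ C N _ f hp5 hC hgood hap hr hf ϖ hϖ L hL htors P n hP hgen hdiv hndiv q hq
  have hp2 : p ≠ 2 := by omega
  haveI : Finite W.sha := (hGZK W hr.le).2
  have h1V : QuadraticBranchPlusMainConjectureAt V p := h1 V C hC hgood hap
  have hne : PowerSeries.coeff 1 L ≠ 0 :=
    coeff_one_ne_zero_of_exactReading W p hPT hp2 C hC hgood hap hL hP hgen hdiv hndiv
      fun κ γ hκ hγ hγc D L' hLL' ↦ h74x V C hp2 hC hgood hap h1V hf ϖ hϖ L hL κ γ hκ hγ hγc D L' hLL'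
  exact ⟨hne, by
    rw [valuation_coeff_one_eq_of_bsdp_of_exactControl W p hmod hB
      (LevelBridge.quadraticBranchOddStrictExactControlOfPlusMCAt_of_readings W p hPT hGZK hR2 h74x) hp5 hC hgood
      hap h1V hf hϖ hL htors hP hgen hdiv hndiv hr hne q hq, add_zero]⟩

/-! ## §3 Class level: the crux ⟺ `BSD_p` on the type, modulo the route's own support items -/

omit [W.IsGloballyMinimal] in
/-- The twins of a curve of signed type `(p, I₀*)` are CM with `p` inert: `HasCM` and `CMInert` depend
on `j` only, and `j(C • W^{(d)}) = j(W)`. Bookkeeping. [cite: SilvermanAEC2009, III.1.4(b) and X.5.4] -/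
theorem hasCM_and_cmInert_of_twist (hT : HasSignedLocalType W p (.Istar 0))
    {V : WeierstrassCurve ℚ} [V.IsElliptic] (C : VariableChange ℚ)
    (hCV : C • W.quadraticTwist ((-1) ^ (p / 2) * p) = V) : V.HasCM ∧ CMInert V p := by
  have hd : ((-1 : ℚ) ^ (p / 2) * p) ≠ 0 :=
    mul_ne_zero (pow_ne_zero _ (by norm_num)) (Nat.cast_ne_zero.mpr hp.out.ne_zero)
  have hCM : V.HasCM := X12.hasCM_of_smul_quadraticTwist W hT.1 hd V C hCV
  haveI : (W.quadraticTwist ((-1 : ℚ) ^ (p / 2) * p)).IsElliptic := W.isElliptic_quadraticTwist hd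
  have hin : CMInert W p := hT.2.1
  refine ⟨hCM, ?_⟩
  subst hCV
  have hj : (C • W.quadraticTwist ((-1 : ℚ) ^ (p / 2) * p)).j = W.j := by
    rw [variableChange_j, W.j_quadraticTwist hd]
  unfold CMInert CMRamified CMSplit at hin ⊢
  rw [hj]
  exact hin

/-- **`BSD_p` on the type ⟹ the crux**, given the route's `PrintReadingsInert` (item 19226: (C1_η) on the
CM good-inert curves, (R2) and the exact Thm-7.4 reading on the type) and the named facts `hmod`,
`hGZK`, `hPT`. CONDITIONAL; nothing booked. [cite: Kobayashi2003, §4 (p. 8), Thm. 7.4 (p. 13)]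
[cite: Miller2011LMS, §1 and Def. 1.1] -/
theorem cccOneLawOnTypeIstarZero_of_bsdpOnType
    (h₅ : Summit.BirchSwinnertonDyer.BirchSwinnertonDyer.Theses.InertBadSignedBranches.PrintReadingsInert)
    (hmod : hasEntireLFunction_rat) (hGZK : rank_eq_analyticRank_of_analyticRank_le_one)
    (hPT : poitouTate_selmerStructure_duality_real ℚ)
    (hB : ∀ (p : ℕ) [Fact p.Prime], 5 ≤ p → ∀ (W : WeierstrassCurve ℚ) [W.IsElliptic]
      [W.IsGloballyMinimal], HasSignedLocalType W p (.Istar 0) → W.analyticRank = 1 → BSDp W p) :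
    Summit.BirchSwinnertonDyer.BirchSwinnertonDyer.Theses.InertBadSignedBranches.CccOneLawOnTypeIstarZero := by
  unfold Summit.BirchSwinnertonDyer.BirchSwinnertonDyer.Theses.InertBadSignedBranches.CccOneLawOnTypeIstarZero
  intro p _ hp5 W _ _ hT hr
  obtain ⟨hC1, hRd⟩ := h₅ p hp5
  obtain ⟨hR2, h74x⟩ := hRd W hT hr
  refine quadraticBranchPAdicGrossZagierValuationAt_of_bsdp_of_readings W p hmod hGZK hPT
    (hB p hp5 W hT hr) hR2 h74x fun V _ _ C hC hgood hap ↦ ?_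
  obtain ⟨hCM, hin⟩ := hasCM_and_cmInert_of_twist W p hT C hC
  exact hC1 V hCM hgood hin

/-- **THE CRUX ⟺ `BSD_p` ON THE TYPE, modulo the route's own support items** `PrintReadingsInert`
(19226) and `PublishedFactsInert` (19227): `CccOneLawOnTypeIstarZero ↔ ∀ p ≥ 5, ∀ W of signed type
(p, I₀*) with r_an(W) = 1, BSDp W p`. Forward = the class node of record (x1b p402929 fed with Mazur's
period datum `Additive.periodRatio_of_mazur`, as in the route's deciding bridge
`CMRungInputs.cmInertBad_of_inputs`); backward = §2. CONDITIONAL on the two support items (hypotheses);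
nothing booked; O10 stays OPEN. [cite: Kobayashi2003, §4 (p. 8), Thm. 7.4 (p. 13), Thm. 9.3 (p. 26)]
[cite: Miller2011LMS, §1 and Def. 1.1] [cite: Mazur1978, Cor. 4.1] -/
theorem cccOneLawOnTypeIstarZero_iff_bsdpOnType
    (h₅ : Summit.BirchSwinnertonDyer.BirchSwinnertonDyer.Theses.InertBadSignedBranches.PrintReadingsInert)
    (h₆ : Summit.BirchSwinnertonDyer.BirchSwinnertonDyer.Theses.InertBadSignedBranches.PublishedFactsInert) :
    Summit.BirchSwinnertonDyer.BirchSwinnertonDyer.Theses.InertBadSignedBranches.CccOneLawOnTypeIstarZero ↔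
      ∀ (p : ℕ) [Fact p.Prime], 5 ≤ p → ∀ (W : WeierstrassCurve ℚ) [W.IsElliptic]
        [W.IsGloballyMinimal], HasSignedLocalType W p (.Istar 0) → W.analyticRank = 1 → BSDp W p := by
  obtain ⟨hmod, hGZ, hGZK, hPT, hnf, hM⟩ := h₆
  refine ⟨fun h₁ p _ hp5 W _ _ hT hr ↦ ?_, fun hB ↦ cccOneLawOnTypeIstarZero_of_bsdpOnType h₅ hmod hGZK hPT hB⟩
  obtain ⟨hC1, hRd⟩ := h₅ p hp5
  obtain ⟨hR2, h74x⟩ := hRd W hT hr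
  exact bsdp_of_hasSignedLocalType_IstarZero_of_valuation_of_readings hmod hGZ hGZK hPT hnf
    (periodRatio_of_mazur p hM hp5) hC1 W (h₁ p hp5 W hT hr) hR2 h74x hT hr hp5

/-! ## §4 At `p ≥ 11`: the `p`-slice of the crux ⟺ the LOWER HALF on the type (upper half published) -/

/-- **At each `p ≥ 11`: C-cc-1 on `(p, I₀*)` ⟺ `LowerHalfOnType p I₀*`** (`ord_p #Ш(W)_an ≤ ord_p #Ш(W)`
for every rank-one `W` of the type), modulo `PrintReadingsInert`, `PublishedFactsInert` and the eleven
published facts of x1b's every-curve UPPER half on the inert core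
(`X12.bsdp_iff_missingLowerBoundAt_of_classX12_of_cmInert`: Gross–Zagier and Kolyvagin over a
Friedberg–Hoffstein field in Matar–Nekovář's irreducible form, GZK, modularity, the CM rank-zero
triple for the twist, Edixhoven's and Deuring's theorems for the Manin constant, Cassels). A curve of
the type lies in `ClassX12` with `p` neither ramified nor split (`classX12_of_hasSignedLocalType`).
READING: at `p ≥ 11` the crux has no content beyond the main-conjecture half of `BSD_p` on the type
(x1b `InertCoreStepL`: = STEP L / Kolyvagin's `m_∞` at every Heegner datum). CONDITIONAL; nothing booked.
[cite: MatarNekovar2019, Thm. 0.3 and §0.11] [cite: EdixhovenManin1991, Thm. 3]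
[cite: BurungaleFlach2024, Thm. 1.1 and Cor. 2] [cite: Miller2011LMS, §1 and Def. 1.1] -/
theorem cccOneLawAt_iff_lowerHalfOnType_of_seven_lt
    (h₅ : Summit.BirchSwinnertonDyer.BirchSwinnertonDyer.Theses.InertBadSignedBranches.PrintReadingsInert)
    (h₆ : Summit.BirchSwinnertonDyer.BirchSwinnertonDyer.Theses.InertBadSignedBranches.PublishedFactsInert)
    (hGZ : ∀ (N : ℕ) [NeZero N] (W : WeierstrassCurve ℚ) (K : Type) [Field K] [NumberField K],
      gross_zagier N W K)
    (hKo : ∀ (N : ℕ) [NeZero N] (W : WeierstrassCurve ℚ) (K : Type) [Field K] [NumberField K],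
      kolyvagin N W K)
    (hMN : ∀ (N : ℕ) [NeZero N] (W : WeierstrassCurve ℚ) (K : Type) [Field K] [NumberField K],
      MatarNekovar2019.thm03_padicValNat_card_sha_le_of_irreducible N W K)
    (hFH : friedbergHoffstein_exists_heegnerField_split_twist_ne_zero)
    (hCM8 : bsdTriple_of_hasCM_of_L_one_ne_zero)
    (hEdx : edixhoven_not_dvd_maninConstant_of_not_potentiallyGoodOrdinary)
    (hDeu : deuring_not_hasUnitRootAt_of_hasCM_of_not_cmSplit) (hCassels : bsdRHS_eq_of_isIsogenous)
    (hp7 : 7 < p) :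
    (∀ (W : WeierstrassCurve ℚ) [W.IsElliptic] [W.IsGloballyMinimal],
        HasSignedLocalType W p (.Istar 0) → W.analyticRank = 1 →
        QuadraticBranchPAdicGrossZagierValuationAt W p) ↔ LowerHalfOnType p (.Istar 0) := by
  have hp5 : 5 ≤ p := by omega
  obtain ⟨hmod, hGZ', hGZK, hPT, hnf, hM⟩ := h₆
  obtain ⟨hC1, hRd⟩ := h₅ p hp5
  refine ⟨fun h ↦ lowerHalfOnType_of_forall_bsdp hGZK fun W _ _ hT hr ↦ ?_, fun hlow W _ _ hT hr ↦ ?_⟩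
  · obtain ⟨hR2, h74x⟩ := hRd W hT hr
    exact bsdp_of_hasSignedLocalType_IstarZero_of_valuation_of_readings hmod hGZ' hGZK hPT hnf
      (periodRatio_of_mazur p hM hp5) hC1 W (h W hT hr) hR2 h74x hT hr hp5
  · obtain ⟨hR2, h74x⟩ := hRd W hT hr
    have hB : BSDp W p :=
      X12.bsdp_of_classX12_of_cmInert_of_lower hGZ hKo hMN hGZK hmod hnf hFH hCM8 hEdx hDeu hCassels W p
        (classX12_of_hasSignedLocalType W p hT hr) hp7 hT.2.1.1 hT.2.1.2 (hlow W hT hr)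
    refine quadraticBranchPAdicGrossZagierValuationAt_of_bsdp_of_readings W p hmod hGZK hPT hB hR2 h74x
      fun V _ _ C hC hgood hap ↦ ?_
    obtain ⟨hCM, hin⟩ := hasCM_and_cmInert_of_twist W p hT C hC
    exact hC1 V hCM hgood hin

/-- **Hence the crux FOLLOWS from the lower half on the type at every `p ≥ 5` together with `BSD_p` on
the type at `p ∈ {5, 7}`** (where the every-curve upper half carries a Manin datum, kept abstract as
`BSD_p` itself), modulo the same support items and published facts. CONDITIONAL; nothing booked.
[cite: MatarNekovar2019, Thm. 0.3 and §0.11] [cite: EdixhovenManin1991, Thm. 3] [cite: Miller2011LMS, §1 and Def. 1.1] -/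
theorem cccOneLawOnTypeIstarZero_of_lowerHalfOnType_of_bsdp_five_seven
    (h₅ : Summit.BirchSwinnertonDyer.BirchSwinnertonDyer.Theses.InertBadSignedBranches.PrintReadingsInert)
    (h₆ : Summit.BirchSwinnertonDyer.BirchSwinnertonDyer.Theses.InertBadSignedBranches.PublishedFactsInert)
    (hGZ : ∀ (N : ℕ) [NeZero N] (W : WeierstrassCurve ℚ) (K : Type) [Field K] [NumberField K],
      gross_zagier N W K)
    (hKo : ∀ (N : ℕ) [NeZero N] (W : WeierstrassCurve ℚ) (K : Type) [Field K] [NumberField K],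
      kolyvagin N W K)
    (hMN : ∀ (N : ℕ) [NeZero N] (W : WeierstrassCurve ℚ) (K : Type) [Field K] [NumberField K],
      MatarNekovar2019.thm03_padicValNat_card_sha_le_of_irreducible N W K)
    (hFH : friedbergHoffstein_exists_heegnerField_split_twist_ne_zero)
    (hCM8 : bsdTriple_of_hasCM_of_L_one_ne_zero)
    (hEdx : edixhoven_not_dvd_maninConstant_of_not_potentiallyGoodOrdinary)
    (hDeu : deuring_not_hasUnitRootAt_of_hasCM_of_not_cmSplit) (hCassels : bsdRHS_eq_of_isIsogenous)
    (hlow : ∀ (p : ℕ) [Fact p.Prime], 7 < p → LowerHalfOnType p (.Istar 0))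
    (h57 : ∀ (p : ℕ) [Fact p.Prime], p = 5 ∨ p = 7 → ∀ (W : WeierstrassCurve ℚ) [W.IsElliptic]
      [W.IsGloballyMinimal], HasSignedLocalType W p (.Istar 0) → W.analyticRank = 1 → BSDp W p) :
    Summit.BirchSwinnertonDyer.BirchSwinnertonDyer.Theses.InertBadSignedBranches.CccOneLawOnTypeIstarZero := by
  have h₆' := h₆
  obtain ⟨hmod, -, hGZK, hPT, -, -⟩ := h₆'
  refine cccOneLawOnTypeIstarZero_of_bsdpOnType h₅ hmod hGZK hPT fun p _ hp5 W _ _ hT hr ↦ ?_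
  by_cases hp7 : 7 < p
  · have hlaw := (cccOneLawAt_iff_lowerHalfOnType_of_seven_lt p h₅ h₆ hGZ hKo hMN hFH hCM8 hEdx
      hDeu hCassels hp7).mpr (hlow p hp7) W hT hr
    obtain ⟨-, hGZ', -, -, hnf, hM⟩ := h₆
    obtain ⟨hC1, hRd⟩ := h₅ p hp5
    obtain ⟨hR2, h74x⟩ := hRd W hT hr
    exact bsdp_of_hasSignedLocalType_IstarZero_of_valuation_of_readings hmod hGZ' hGZK hPT hnf
      (periodRatio_of_mazur p hM hp5) hC1 W hlaw hR2 h74x hT hr hp5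
  · have hpP : p.Prime := Fact.out
    have h57' : p = 5 ∨ p = 7 := by
      have hle : p ≤ 7 := Nat.le_of_not_lt hp7
      interval_cases p <;> simp_all (config := {decide := true})
    exact h57 p h57' W hT hr

/-! ## §5 The sub-type rung: pairs whose analytic `#Ш` is a certified `p`-adic unit (route T-KR) -/

/-- **C-cc-1 at every pair `(W, p)` of the type with `p ≥ 11` and `ord_p #Ш(W)_an = 0`**, modulo
`PrintReadingsInert`, `PublishedFactsInert` and the published facts of the every-curve upper half:
route T-KR (`X12.bsdp_of_classX12_of_cmInert_of_shaAn_unit`: the upper half forces `Ш(W)[p] = 0`, so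
`BSD(W, p)`) followed by §2. The datum `#Ш(W)_an = q`, `ord_p q = 0` is the lane's certified per-pair
datum (274/274 O10-PS census pairs, x1b E1-η); `r_an(W) = 1` is the lane's analytic datum. PER PAIR;
CONDITIONAL; nothing booked; the class-level crux stays OPEN.
[cite: MatarNekovar2019, Thm. 0.3 and §0.11] [cite: EdixhovenManin1991, Thm. 3] [cite: Miller2011LMS, §1 and Def. 1.1] -/
theorem quadraticBranchPAdicGrossZagierValuationAt_of_shaAn_unit_of_seven_lt
    (h₅ : Summit.BirchSwinnertonDyer.BirchSwinnertonDyer.Theses.InertBadSignedBranches.PrintReadingsInert)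
    (h₆ : Summit.BirchSwinnertonDyer.BirchSwinnertonDyer.Theses.InertBadSignedBranches.PublishedFactsInert)
    (hGZ : ∀ (N : ℕ) [NeZero N] (W : WeierstrassCurve ℚ) (K : Type) [Field K] [NumberField K],
      gross_zagier N W K)
    (hKo : ∀ (N : ℕ) [NeZero N] (W : WeierstrassCurve ℚ) (K : Type) [Field K] [NumberField K],
      kolyvagin N W K)
    (hMN : ∀ (N : ℕ) [NeZero N] (W : WeierstrassCurve ℚ) (K : Type) [Field K] [NumberField K],
      MatarNekovar2019.thm03_padicValNat_card_sha_le_of_irreducible N W K)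
    (hFH : friedbergHoffstein_exists_heegnerField_split_twist_ne_zero)
    (hCM8 : bsdTriple_of_hasCM_of_L_one_ne_zero)
    (hEdx : edixhoven_not_dvd_maninConstant_of_not_potentiallyGoodOrdinary)
    (hDeu : deuring_not_hasUnitRootAt_of_hasCM_of_not_cmSplit) (hCassels : bsdRHS_eq_of_isIsogenous)
    (hp7 : 7 < p) (hT : HasSignedLocalType W p (.Istar 0)) (hr : W.analyticRank = 1)
    {q : ℚ} (hq : shaAn W = (q : ℂ)) (hv : padicValRat p q = 0) :
    QuadraticBranchPAdicGrossZagierValuationAt W p := by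
  have hp5 : 5 ≤ p := by omega
  obtain ⟨hmod, -, hGZK, hPT, hnf, -⟩ := h₆
  obtain ⟨hC1, hRd⟩ := h₅ p hp5
  obtain ⟨hR2, h74x⟩ := hRd W hT hr
  have hB : BSDp W p :=
    X12.bsdp_of_classX12_of_cmInert_of_shaAn_unit hGZ hKo hMN hGZK hmod hnf hFH hCM8 hEdx hDeu hCassels W p
      (classX12_of_hasSignedLocalType W p hT hr) hp7 hT.2.1.1 hT.2.1.2 hq hv
  refine quadraticBranchPAdicGrossZagierValuationAt_of_bsdp_of_readings W p hmod hGZK hPT hB hR2 h74x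
    fun V _ _ C hC hgood hap ↦ ?_
  obtain ⟨hCM, hin⟩ := hasCM_and_cmInert_of_twist W p hT C hC
  exact hC1 V hCM hgood hin

end Summit.BirchSwinnertonDyer.BirchSwinnertonDyer.Theorems.CccOneLowerHalf

end
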